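import Summits.CriticalPhenomena.PercolationContinuityZ3.Theorems.PercNearOneGluingNoHeavyLowerTailTwoPartitionFourTerm
import HarnessLib.Audit

/-!
# `NoHeavyLowerTail` (crux stmt-CriticalPhenomena-4575), master-family hierarchy P3 (gen 31): the HALL FORM `ThreeSetHall` of the conjecture
# `ThreeSetAntipodal` (a monotone injection of debts into targets) and the reduction `ThreeSetHall → ThreeSetAntipodal`

Support file (seat `prim-masterthm-p3`; `--supports stmt-CriticalPhenomena-4575`; memo
`run/shared/lean/prim/prim-masterthm/FROM-prim-masterthm-p3-g31-HALL-FORM.md`, HIERARCHY §38).  Companion of `…TwoPartitionFourTerm`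
(counting form `threeSetN_eq_card_sub`: `threeSetN 𝒜 ℬ 𝒞 = #(𝒜ℬ𝒞) − #(𝒜ℬ ∩ (𝒜𝒞)ᶜˢ) − #(𝒜 ∩ (ℬ𝒞 ∖ 𝒜)ᶜˢ)`, targets minus debts).

**HALL FORM** (`ThreeSetHall`, CONJECTURE, this work): for up-sets `𝒳, 𝒴, 𝒵` meeting pairwise in the same family `𝒫` and an up-set `𝒲` with
`𝒲 ∩ 𝒴 ⊆ 𝒫`:  `#(𝒲 ∩ 𝒳 ∩ 𝒵ᶜˢ) + #(𝒲 ∩ (𝒴 ∖ 𝒫)ᶜˢ) ≤ #(𝒲 ∩ 𝒫)`.  With `𝒳 = 𝒜ℬ, 𝒵 = 𝒜𝒞, 𝒴 = ℬ𝒞, 𝒲 = 𝒜` this is the counting form, so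
`ThreeSetHall → ThreeSetAntipodal` (`threeSetAntipodal_of_threeSetHall`); ranging over all `𝒲` it is, by P. Hall's theorem, the statement that the
debts `{S ∈ 𝒳 : Sᶜ ∈ 𝒵} ⊔ {S ∈ 𝒲 : Sᶜ ∈ 𝒴 ∖ 𝒫}` can be matched INJECTIVELY AND MONOTONICALLY into the targets `𝒲 ∩ 𝒫` (`S ↦ φ S ⊇ S`) — the
extra parameter `𝒲` is exactly the "modified layer kernel" that a layered induction needs (gens 26/30: layered certificates exist but not with the
Base kernels).  The case `𝒲 ⊆ 𝒳` is Harris–Kleitman for `(𝒲, 𝒴 ∪ 𝒵)` (`card_inter_compls_union_le`).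
EVIDENCE (not in the kernel; seat folder `code/hall.c`): true for every instance on `2^[n]`, `n ≤ 5` (n = 5: all 936 695 817 triples
`𝒳, 𝒵 ⊆ 𝒜` over the 210 `S₅`-orbits of `𝒜`, Hall's condition checked by bipartite matching) and for `10⁸` random instances on `2^[6]`; the
type-level (per complementary pair) layered induction that proves Kleitman does NOT close it (an exact rational LP over 692 pointwise-definable layer
instances is infeasible, optimum −6/13) — the obstruction of a split along one coordinate is the family `(𝒴∖𝒫)₀ ∩ 𝒫₁`.
HONEST LABEL: a conjecture (obligation, never a fact) and a conditional reduction; `ThreeSetAntipodal` and `ThreeSetHall` remain OPEN. [this work]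
-/

namespace Summit.CriticalPhenomena.PercolationContinuityZ3.Theorems.TwoPartition

open Finset
open scoped FinsetFamily

/-! ### The Hall form of the conjecture -/

/-- **CONJECTURE `ThreeSetHall`** (this work; open): for up-sets `𝒳, 𝒴, 𝒵` of a finite cube meeting pairwise in the same family
`𝒫 = 𝒳 ∩ 𝒵 = 𝒳 ∩ 𝒴 = 𝒴 ∩ 𝒵` and every up-set `𝒲` with `𝒲 ∩ 𝒴 ⊆ 𝒫`,
`#(𝒲 ∩ 𝒳 ∩ 𝒵ᶜˢ) + #(𝒲 ∩ (𝒴 ∖ 𝒫)ᶜˢ) ≤ #(𝒲 ∩ 𝒫)`.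
By P. Hall's theorem this says: the debts `{S ∈ 𝒳 : Sᶜ ∈ 𝒵} ⊔ {S : Sᶜ ∈ 𝒴 ∖ 𝒫}` of the largest admissible `𝒲` inject into `𝒫` along
`S ↦ φ S ⊇ S`.  Verified for all instances on `2^[n]`, `n ≤ 5`, and `10⁸` random ones on `2^[6]`; the case `𝒲 ⊆ 𝒳` is
`card_inter_compls_union_le`.  An obligation / hypothesis — never a fact. [this work] [status: open] -/
@[conjecture] def ThreeSetHall : Prop :=
  ∀ (n : ℕ) (𝒲 𝒳 𝒴 𝒵 : Finset (Finset (Fin n))), IsUpperSet (𝒲 : Set (Finset (Fin n))) → IsUpperSet (𝒳 : Set (Finset (Fin n))) →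
    IsUpperSet (𝒴 : Set (Finset (Fin n))) → IsUpperSet (𝒵 : Set (Finset (Fin n))) →
    𝒳 ∩ 𝒴 = 𝒳 ∩ 𝒵 → 𝒴 ∩ 𝒵 = 𝒳 ∩ 𝒵 → 𝒲 ∩ 𝒴 ⊆ 𝒳 ∩ 𝒵 →
    #(𝒲 ∩ 𝒳 ∩ 𝒵ᶜˢ) + #(𝒲 ∩ (𝒴 \ (𝒳 ∩ 𝒵))ᶜˢ) ≤ #(𝒲 ∩ 𝒳 ∩ 𝒵)

/-- **`ThreeSetHall → ThreeSetAntipodal`** (this work): take `𝒲 = 𝒜`, `𝒳 = 𝒜∩ℬ`, `𝒴 = ℬ∩𝒞`, `𝒵 = 𝒜∩𝒞` in the Hall form and use the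
counting form `threeSetN_eq_card_sub`. [this work] -/
theorem threeSetAntipodal_of_threeSetHall (h : ThreeSetHall) : ThreeSetAntipodal := by
  intro n 𝒜 ℬ 𝒞 h𝒜 hℬ h𝒞
  have hX := isUpperSet_inter' h𝒜 hℬ
  have hY := isUpperSet_inter' hℬ h𝒞
  have hZ := isUpperSet_inter' h𝒜 h𝒞
  have e1 : 𝒜 ∩ ℬ ∩ (ℬ ∩ 𝒞) = 𝒜 ∩ ℬ ∩ (𝒜 ∩ 𝒞) := by ext S; simp only [mem_inter]; tauto
  have e2 : ℬ ∩ 𝒞 ∩ (𝒜 ∩ 𝒞) = 𝒜 ∩ ℬ ∩ (𝒜 ∩ 𝒞) := by ext S; simp only [mem_inter]; tauto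
  have e3 : 𝒜 ∩ (ℬ ∩ 𝒞) ⊆ 𝒜 ∩ ℬ ∩ (𝒜 ∩ 𝒞) := by intro S; simp only [mem_inter]; tauto
  have key := h n 𝒜 (𝒜 ∩ ℬ) (ℬ ∩ 𝒞) (𝒜 ∩ 𝒞) h𝒜 hX hY hZ e1 e2 e3
  have e4 : 𝒜 ∩ (𝒜 ∩ ℬ) ∩ (𝒜 ∩ 𝒞) = 𝒜 ∩ ℬ ∩ 𝒞 := by ext S; simp only [mem_inter]; tauto
  have e5 : 𝒜 ∩ (𝒜 ∩ ℬ) ∩ (𝒜 ∩ 𝒞)ᶜˢ = 𝒜 ∩ ℬ ∩ (𝒜 ∩ 𝒞)ᶜˢ := by rw [← inter_assoc, inter_self]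
  have e6 : (ℬ ∩ 𝒞) \ (𝒜 ∩ ℬ ∩ (𝒜 ∩ 𝒞)) = (ℬ ∩ 𝒞) \ 𝒜 := by
    ext S; simp only [mem_sdiff, mem_inter]; tauto
  rw [e4, e5, e6] at key
  rw [threeSetN_eq_card_sub]
  omega

/-! ### The generalisation `G` (gen 31, appended): `Z` meets `X` and `Y` only in a common part `Q ⊆ P` -/

/-- **CONJECTURE `ThreeSetHallG`** (this work; open): for up-sets `𝒲, 𝒳, 𝒴, 𝒵` of a finite cube with `𝒳 ∩ 𝒵 = 𝒴 ∩ 𝒵` (`=: 𝒬 ⊆ 𝒫 := 𝒳 ∩ 𝒴`; `𝒵` need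
NOT contain `𝒫`) and `𝒲 ∩ 𝒴 ⊆ 𝒫`:  `#(𝒲 ∩ 𝒳 ∩ 𝒵ᶜˢ) + #(𝒲 ∩ (𝒴 ∖ 𝒬)ᶜˢ) ≤ #(𝒲 ∩ 𝒫)`.  `𝒬 = 𝒫` is `ThreeSetHall`; `𝒵 = ∅` is Harris–Kleitman for
`(𝒲, 𝒴)`.  Why this family: under a one-coordinate split the layer-1 obligations of an instance are EXACTLY the instance `(𝒲₁; 𝒳₁, 𝒴₁, 𝒵₀)` (the
"(Y,P)-point" defect of `ThreeSetHall` disappears); layer 0 is not closed (memo §0 (E)).  EVIDENCE (seat folder `code/gtest.c`, `code/gsample.c`): all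
2 567 857 080 instances on `2^[n]`, `n ≤ 4`; `6·10⁷` random instances on `2^[5]` and `4·10⁷` on `2^[6]` in matching form; 0 failures.
An obligation / hypothesis — never a fact. [this work] [status: open] -/
@[conjecture] def ThreeSetHallG : Prop :=
  ∀ (n : ℕ) (𝒲 𝒳 𝒴 𝒵 : Finset (Finset (Fin n))), IsUpperSet (𝒲 : Set (Finset (Fin n))) → IsUpperSet (𝒳 : Set (Finset (Fin n))) →
    IsUpperSet (𝒴 : Set (Finset (Fin n))) → IsUpperSet (𝒵 : Set (Finset (Fin n))) →
    𝒳 ∩ 𝒵 = 𝒴 ∩ 𝒵 → 𝒲 ∩ 𝒴 ⊆ 𝒳 ∩ 𝒴 →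
    #(𝒲 ∩ 𝒳 ∩ 𝒵ᶜˢ) + #(𝒲 ∩ (𝒴 \ (𝒳 ∩ 𝒵))ᶜˢ) ≤ #(𝒲 ∩ 𝒳 ∩ 𝒴)

/-- **`ThreeSetHallG → ThreeSetHall`** (this work): the Hall form is the case `𝒳 ∩ 𝒵 = 𝒴 ∩ 𝒵 = 𝒳 ∩ 𝒴`. [this work] -/
theorem threeSetHall_of_threeSetHallG (h : ThreeSetHallG) : ThreeSetHall := by
  intro n 𝒲 𝒳 𝒴 𝒵 h𝒲 h𝒳 h𝒴 h𝒵 hXY hYZ hW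
  have hXZ : 𝒳 ∩ 𝒵 = 𝒴 ∩ 𝒵 := hYZ.symm
  have hW' : 𝒲 ∩ 𝒴 ⊆ 𝒳 ∩ 𝒴 := by rw [hXY]; exact hW
  have key := h n 𝒲 𝒳 𝒴 𝒵 h𝒲 h𝒳 h𝒴 h𝒵 hXZ hW'
  have e : 𝒲 ∩ 𝒳 ∩ 𝒴 = 𝒲 ∩ 𝒳 ∩ 𝒵 := by rw [inter_assoc, hXY, ← inter_assoc]
  rw [e] at key
  exact key

/-- **`ThreeSetHallG → ThreeSetAntipodal`** (this work). [this work] -/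
theorem threeSetAntipodal_of_threeSetHallG (h : ThreeSetHallG) : ThreeSetAntipodal :=
  threeSetAntipodal_of_threeSetHall (threeSetHall_of_threeSetHallG h)

/-! ### The cleanest form `G″` (gen 31, appended): `Z` avoids `X ∖ P`, `W` avoids `Y ∖ P` -/

/-- **CONJECTURE `ThreeSetHallG2`** (this work; open): for up-sets `𝒲, 𝒳, 𝒴, 𝒵` of a finite cube with `𝒳 ∩ 𝒵 ⊆ 𝒫 := 𝒳 ∩ 𝒴` and `𝒲 ∩ 𝒴 ⊆ 𝒫`:
`#(𝒲 ∩ 𝒳 ∩ 𝒵ᶜˢ) + #(𝒲 ∩ (𝒴 ∖ 𝒵)ᶜˢ) ≤ #(𝒲 ∩ 𝒫)` — the members of `𝒲 ∩ 𝒳` whose complement lies in `𝒵`, together with the members of `𝒲` whose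
complement lies in `𝒴 ∖ 𝒵`, inject monotonically into `𝒲 ∩ 𝒫`.  `𝒳 ∩ 𝒵 = 𝒴 ∩ 𝒵` is `ThreeSetHallG`; `𝒵 = ∅` or `𝒵 = 𝒴` is Harris–Kleitman.  Under a
one-coordinate split the layer-1 obligations are exactly the instance `(𝒲₁; 𝒳₁, 𝒴₁, 𝒵₀)`; the only residual of the induction is the transfer of layer-0
debts whose complement lies below `𝒵₁ ∩ 𝒳₀ ∖ 𝒴₀` (memo §0 (E')).  EVIDENCE (seat folder `code/g2test.c`, `code/g2sample.c`): all 116 673 012 instances on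
`2^[n]`, `n ≤ 4`; `3·10⁷` random instances on `2^[5]` and `2·10⁷` on `2^[6]` in matching form; 0 failures.  An obligation / hypothesis — never a fact.
[this work] [status: open] -/
@[conjecture] def ThreeSetHallG2 : Prop :=
  ∀ (n : ℕ) (𝒲 𝒳 𝒴 𝒵 : Finset (Finset (Fin n))), IsUpperSet (𝒲 : Set (Finset (Fin n))) → IsUpperSet (𝒳 : Set (Finset (Fin n))) →
    IsUpperSet (𝒴 : Set (Finset (Fin n))) → IsUpperSet (𝒵 : Set (Finset (Fin n))) →
    𝒳 ∩ 𝒵 ⊆ 𝒳 ∩ 𝒴 → 𝒲 ∩ 𝒴 ⊆ 𝒳 ∩ 𝒴 →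
    #(𝒲 ∩ 𝒳 ∩ 𝒵ᶜˢ) + #(𝒲 ∩ (𝒴 \ 𝒵)ᶜˢ) ≤ #(𝒲 ∩ 𝒳 ∩ 𝒴)

/-- **`ThreeSetHallG2 → ThreeSetHallG`** (this work): under `𝒳 ∩ 𝒵 = 𝒴 ∩ 𝒵` one has `𝒳 ∩ 𝒵 ⊆ 𝒳 ∩ 𝒴` and `𝒴 ∖ (𝒳 ∩ 𝒵) = 𝒴 ∖ 𝒵`. [this work] -/
theorem threeSetHallG_of_threeSetHallG2 (h : ThreeSetHallG2) : ThreeSetHallG := by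
  intro n 𝒲 𝒳 𝒴 𝒵 h𝒲 h𝒳 h𝒴 h𝒵 hXZ hW
  have h1 : 𝒳 ∩ 𝒵 ⊆ 𝒳 ∩ 𝒴 := fun S hS => by
    have hS' : S ∈ 𝒴 ∩ 𝒵 := by rw [← hXZ]; exact hS
    exact mem_inter.2 ⟨(mem_inter.1 hS).1, (mem_inter.1 hS').1⟩
  have e : 𝒴 \ (𝒳 ∩ 𝒵) = 𝒴 \ 𝒵 := by
    ext S
    simp only [mem_sdiff, mem_inter, not_and]
    constructor
    · rintro ⟨hY, hn⟩
      refine ⟨hY, fun hZ => ?_⟩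
      have hx : S ∈ 𝒳 ∩ 𝒵 := by rw [hXZ]; exact mem_inter.2 ⟨hY, hZ⟩
      exact hn (mem_inter.1 hx).1 hZ
    · rintro ⟨hY, hnZ⟩
      exact ⟨hY, fun _ hZ => hnZ hZ⟩
  have key := h n 𝒲 𝒳 𝒴 𝒵 h𝒲 h𝒳 h𝒴 h𝒵 h1 hW
  rw [e]
  exact key

/-- **`ThreeSetHallG2 → ThreeSetAntipodal`** (this work). [this work] -/
theorem threeSetAntipodal_of_threeSetHallG2 (h : ThreeSetHallG2) : ThreeSetAntipodal :=
  threeSetAntipodal_of_threeSetHallG (threeSetHallG_of_threeSetHallG2 h)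

end Summit.CriticalPhenomena.PercolationContinuityZ3.Theorems.TwoPartition
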